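import Summits.ResolutionOfSingularities.KangarooAtlas.MizutaniThetaStep
import HarnessLib

/-!
# Echelon bases of the tower spans and the step count `dim Θ_{m+1}(v) = dim Θ_m(v) + dim span{∂_l g_j}` (Mizutani 1973, proof of Thm. 2.8)

Cell `pub-rosobs`, Mizutani enclosure (seat mizutani-encloser-2, gen 7). AI-written; AI review is weaker than expert
review; NOT a resolution-of-singularities theorem (summit relevance C).

Mizutani (Nagoya Math. J. 52 (1973), p. 90): «If `dim_k Diff_i(k)f = t`, then we may assume that `Diff_i(k)f` is generated by
`X_j + h_j` (`j = 0, …, t − 1`) over `k`, where `h_j` is a `k`-linear combination of `X_t, …, X_m`» — a REDUCED ECHELON basis; the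
derivatives `D(X_j + h_j) = D(h_j)` are then supported on the non-pivot coordinates and independent of `Diff_i(k)f`.  This file
provides that linear algebra for the tree's `Θ_m(v)` (`MizutaniExtremalProfile.lean`, `MizutaniThetaStep.lean`):

* `exists_echelon` — every subspace `Θ ⊆ K^ι` has a set of pivots `P` and vectors `g_j ∈ Θ` (`j ∈ P`) with `g_j(j') = δ_{jj'}` on `P` and
  `θ = Σ_{j ∈ P} θ_j g_j` for all `θ ∈ Θ`;
* **`IsRootTower.finrank_thetaSpan_succ_eq`** — at exponent one, for such a basis of `Θ_m(v)`:
  `dim_K Θ_{m+1}(v) = dim_K Θ_m(v) + dim_K span_K{∂_l g_j : l, j ∈ P}` (the derivatives vanish on the pivots);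
* `exists_perp_of_finrank_lt` (a subspace of dimension `< #ι` has a nonzero orthogonal vector for `Σ_i w_i θ_i`) and
  `exists_rational_perp` (an orthogonal vector with a coordinate `1` may be replaced by one with coordinates in a subfield `E` containing
  the coordinates of the spanning vectors — an `E`-linear retraction `K → E`).

## References

* H. Mizutani, *Hironaka's additive group schemes*, Nagoya Math. J. 52 (1973) 85–95, proof of Thm. 2.8 (p. 90). [Mizutani1973HironakaGroupSchemes]
-/

noncomputable section

open MvPolynomial Literature.AlgebraicGeometry.Resolution

namespace Summit.ResolutionOfSingularities.KangarooAtlas.Mizutani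

universe u

/-! ## Reduced echelon bases of subspaces of `K^ι` -/

section Echelon

variable {K : Type*} [Field K] {ι : Type*} [Fintype ι] [DecidableEq ι]

/-- **Reduced echelon basis**: a subspace `Θ ⊆ K^ι` has pivots `P ⊆ ι` and vectors `g_j ∈ Θ` (`j ∈ P`) with `g_j(j') = δ_{jj'}`
(`j, j' ∈ P`) such that every `θ ∈ Θ` equals `Σ_{j ∈ P} θ_j · g_j`.
[cite: Mizutani1973HironakaGroupSchemes, proof of Thm. 2.8 (p. 90: «Diff_i(k)f is generated by X_j + h_j»)] -/
theorem exists_echelon (Θ : Submodule K (ι → K)) :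
    ∃ (P : Finset ι) (g : ι → ι → K), (∀ j ∈ P, g j ∈ Θ) ∧ (∀ j ∈ P, ∀ j' ∈ P, g j j' = if j = j' then 1 else 0) ∧
      ∀ θ ∈ Θ, θ = ∑ j ∈ P, θ j • g j := by
  suffices key : ∀ (n : ℕ) (Θ : Submodule K (ι → K)), Module.finrank K Θ = n →
      ∃ (P : Finset ι) (g : ι → ι → K), (∀ j ∈ P, g j ∈ Θ) ∧ (∀ j ∈ P, ∀ j' ∈ P, g j j' = if j = j' then 1 else 0) ∧
        ∀ θ ∈ Θ, θ = ∑ j ∈ P, θ j • g j from key _ Θ rfl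
  intro n
  induction n with
  | zero =>
    intro Θ hΘ
    have hbot : Θ = ⊥ := Submodule.finrank_eq_zero.mp hΘ
    refine ⟨∅, fun _ => 0, by simp, by simp, fun θ hθ => ?_⟩
    rw [hbot, Submodule.mem_bot] at hθ
    rw [hθ, Finset.sum_empty]
  | succ n ih =>
    intro Θ hΘ
    have hne : Θ ≠ ⊥ := by
      intro hbot; rw [hbot, finrank_bot] at hΘ; exact Nat.succ_ne_zero n hΘ.symm
    obtain ⟨θ₀, hθ₀, hθ₀ne⟩ := Submodule.exists_mem_ne_zero_of_ne_bot hne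
    obtain ⟨i₀, hi₀⟩ : ∃ i₀, θ₀ i₀ ≠ 0 := by
      by_contra hall; push Not at hall; exact hθ₀ne (funext hall)
    -- `Θ' = Θ ∩ {θ_{i₀} = 0}` has dimension `n`
    set Θ' : Submodule K (ι → K) := Θ ⊓ LinearMap.ker (LinearMap.proj i₀) with hΘ'def
    have hΘ'mem : ∀ θ, θ ∈ Θ' ↔ θ ∈ Θ ∧ θ i₀ = 0 := fun θ => by
      rw [hΘ'def, Submodule.mem_inf, LinearMap.mem_ker, LinearMap.proj_apply]
    have hdim : Module.finrank K Θ' = n := by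
      set f : Θ →ₗ[K] K := (LinearMap.proj i₀ : (ι → K) →ₗ[K] K).domRestrict Θ with hf
      have hrange : LinearMap.range f = ⊤ := by
        rw [eq_top_iff]
        intro c _
        refine ⟨(c * (θ₀ i₀)⁻¹) • ⟨θ₀, hθ₀⟩, ?_⟩
        rw [map_smul, hf, LinearMap.domRestrict_apply, LinearMap.proj_apply, smul_eq_mul, inv_mul_cancel_right₀ hi₀]
      have hker : (LinearMap.ker f).map Θ.subtype = Θ' := by
        ext θ
        rw [hΘ'mem, Submodule.mem_map]
        constructor
        · rintro ⟨θ', hθ', rfl⟩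
          rw [LinearMap.mem_ker, hf, LinearMap.domRestrict_apply, LinearMap.proj_apply] at hθ'
          exact ⟨θ'.2, hθ'⟩
        · rintro ⟨hθ, hθ0⟩
          refine ⟨⟨θ, hθ⟩, ?_, rfl⟩
          rw [LinearMap.mem_ker, hf, LinearMap.domRestrict_apply, LinearMap.proj_apply]
          exact hθ0
      have hrn := LinearMap.finrank_range_add_finrank_ker f
      rw [hrange, finrank_top, Module.finrank_self, hΘ] at hrn
      have hkereq : Module.finrank K (LinearMap.ker f) = Module.finrank K Θ' := by
        rw [← hker]
        exact (Submodule.equivMapOfInjective Θ.subtype Θ.injective_subtype _).finrank_eq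
      omega
    obtain ⟨P', g', hg'mem, hg'piv, hg'rep⟩ := ih Θ' hdim
    have hi₀P' : i₀ ∉ P' := by
      intro hmem
      have h1 := hg'piv i₀ hmem i₀ hmem
      rw [if_pos rfl] at h1
      have h0 := ((hΘ'mem _).mp (hg'mem i₀ hmem)).2
      rw [h0] at h1
      exact zero_ne_one h1
    -- the new pivot vector
    set θ₁ : ι → K := (θ₀ i₀)⁻¹ • θ₀ with hθ₁
    have hθ₁mem : θ₁ ∈ Θ := Submodule.smul_mem _ _ hθ₀
    have hθ₁i₀ : θ₁ i₀ = 1 := by rw [hθ₁, Pi.smul_apply, smul_eq_mul, inv_mul_cancel₀ hi₀]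
    set g₀ : ι → K := θ₁ - ∑ j ∈ P', θ₁ j • g' j with hg₀
    have hg₀mem : g₀ ∈ Θ :=
      Submodule.sub_mem _ hθ₁mem (Submodule.sum_mem _ fun j hj => Submodule.smul_mem _ _ ((hΘ'mem _).mp (hg'mem j hj)).1)
    have hg₀i₀ : g₀ i₀ = 1 := by
      rw [hg₀, Pi.sub_apply, Finset.sum_apply, hθ₁i₀, Finset.sum_eq_zero (fun j hj => by
        rw [Pi.smul_apply, smul_eq_mul, ((hΘ'mem _).mp (hg'mem j hj)).2, mul_zero]), sub_zero]
    have hg₀P' : ∀ j' ∈ P', g₀ j' = 0 := by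
      intro j' hj'
      rw [hg₀, Pi.sub_apply, Finset.sum_apply]
      simp only [Pi.smul_apply, smul_eq_mul]
      rw [Finset.sum_congr rfl fun j hj => by rw [hg'piv j hj j' hj']]
      simp only [mul_ite, mul_one, mul_zero]
      rw [Finset.sum_ite_eq' P' j', if_pos hj', sub_self]
    have hne_of_mem : ∀ j ∈ P', j ≠ i₀ := fun j hj hji => hi₀P' (hji ▸ hj)
    refine ⟨insert i₀ P', Function.update g' i₀ g₀, ?_, ?_, ?_⟩
    · intro j hj
      by_cases hji : j = i₀
      · rw [hji, Function.update_self]; exact hg₀mem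
      · have hj' : j ∈ P' := (Finset.mem_insert.mp hj).resolve_left hji
        rw [Function.update_of_ne hji]
        exact ((hΘ'mem _).mp (hg'mem j hj')).1
    · intro j hj j' hj'
      by_cases hji : j = i₀
      · subst hji
        rw [Function.update_self]
        by_cases hj'i : j' = j
        · rw [if_pos hj'i.symm, hj'i, hg₀i₀]
        · have hj'P : j' ∈ P' := (Finset.mem_insert.mp hj').resolve_left hj'i
          rw [if_neg (Ne.symm hj'i), hg₀P' j' hj'P]
      · have hjP : j ∈ P' := (Finset.mem_insert.mp hj).resolve_left hji
        rw [Function.update_of_ne hji]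
        by_cases hj'i : j' = i₀
        · rw [hj'i, if_neg hji, ((hΘ'mem _).mp (hg'mem j hjP)).2]
        · exact hg'piv j hjP j' ((Finset.mem_insert.mp hj').resolve_left hj'i)
    · intro θ hθ
      have hθ' : θ - θ i₀ • g₀ ∈ Θ' := by
        rw [hΘ'mem]
        refine ⟨Submodule.sub_mem _ hθ (Submodule.smul_mem _ _ hg₀mem), ?_⟩
        rw [Pi.sub_apply, Pi.smul_apply, smul_eq_mul, hg₀i₀, mul_one, sub_self]
      have hrep := hg'rep _ hθ'
      rw [Finset.sum_insert hi₀P', Function.update_self]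
      have hrest : ∑ j ∈ P', θ j • Function.update g' i₀ g₀ j = ∑ j ∈ P', (θ - θ i₀ • g₀) j • g' j := by
        refine Finset.sum_congr rfl fun j hj => ?_
        rw [Function.update_of_ne (hne_of_mem j hj), Pi.sub_apply, Pi.smul_apply, smul_eq_mul, hg₀P' j hj,
          mul_zero, sub_zero]
      rw [hrest, ← hrep, add_sub_cancel]

omit [Fintype ι] [DecidableEq ι] in
/-- A vector of `Θ` vanishing on all pivots of an echelon basis is zero. [folklore] -/
theorem eq_zero_of_forall_pivot_eq_zero {Θ : Submodule K (ι → K)} {P : Finset ι} {g : ι → ι → K}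
    (hrep : ∀ θ ∈ Θ, θ = ∑ j ∈ P, θ j • g j) {θ : ι → K} (hθ : θ ∈ Θ) (hzero : ∀ j ∈ P, θ j = 0) : θ = 0 := by
  rw [hrep θ hθ]
  exact Finset.sum_eq_zero fun j hj => by rw [hzero j hj, zero_smul]

end Echelon

/-! ## The step count for an echelon basis of `Θ_m(v)` -/

section Count

variable {L K : Type u} [Field L] [Field K] [Algebra L K] {s p : ℕ} [hp : Fact p.Prime] [CharP K p]
  {x : Fin s → L} {a : Fin s → K} {ι : Type*}

/-- The span `N = span_K {∂_l g_j : l, j ∈ P}` of the first derivatives of an echelon basis. [folklore] -/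
def IsRootTower.derivSpan (h : IsRootTower L K (p ^ 1) x a) (P : Finset ι) (g : ι → ι → K) : Submodule K (ι → K) :=
  Submodule.span K {r | ∃ l : Fin s, ∃ j ∈ P, r = h.dvec l (g j)}

/-- `∂_l g_j ∈ N`. [folklore] -/
theorem IsRootTower.dvec_mem_derivSpan (h : IsRootTower L K (p ^ 1) x a) {P : Finset ι} (g : ι → ι → K) (l : Fin s) {j : ι}
    (hj : j ∈ P) : h.dvec l (g j) ∈ h.derivSpan P g :=
  Submodule.subset_span ⟨l, j, hj, rfl⟩

/-- The derivatives of echelon vectors vanish on the pivots (`∂_l 0 = ∂_l 1 = 0`), hence so does all of `N`. [folklore] -/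
theorem IsRootTower.apply_eq_zero_of_mem_derivSpan [DecidableEq ι] (h : IsRootTower L K (p ^ 1) x a) {P : Finset ι} {g : ι → ι → K}
    (hpiv : ∀ j ∈ P, ∀ j' ∈ P, g j j' = if j = j' then 1 else 0) {r : ι → K} (hr : r ∈ h.derivSpan P g) {j' : ι} (hj' : j' ∈ P) :
    r j' = 0 := by
  have hle : h.derivSpan P g ≤ LinearMap.ker (LinearMap.proj j' : (ι → K) →ₗ[K] K) := by
    unfold IsRootTower.derivSpan
    rw [Submodule.span_le]
    rintro _ ⟨l, j, hj, rfl⟩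
    rw [SetLike.mem_coe, LinearMap.mem_ker, LinearMap.proj_apply, h.dvec_apply, hpiv j hj j' hj']
    split_ifs
    · exact h.sigD_one (Finsupp.single_ne_zero.mpr one_ne_zero)
    · exact map_zero _
  have := hle hr
  rwa [LinearMap.mem_ker, LinearMap.proj_apply] at this

/-- **`Θ_{m+1}(v) = Θ_m(v) ⊔ N`** for an echelon basis of `Θ_m(v)` (exponent one). [cite: Mizutani1973HironakaGroupSchemes, proof of Thm. 2.8 (p. 90)] -/
theorem IsRootTower.thetaSpan_succ_eq_sup_derivSpan (h : IsRootTower L K (p ^ 1) x a) (m : ℕ) (v : ι → K) {P : Finset ι}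
    {g : ι → ι → K} (hmem : ∀ j ∈ P, g j ∈ h.thetaSpan m v) (hrep : ∀ θ ∈ h.thetaSpan m v, θ = ∑ j ∈ P, θ j • g j) :
    h.thetaSpan (m + 1) v = h.thetaSpan m v ⊔ h.derivSpan P g := by
  set S : Set (ι → K) := g '' (P : Set ι) with hSdef
  have hS : S ⊆ h.thetaSpan m v := by rintro _ ⟨j, hj, rfl⟩; exact hmem j (Finset.mem_coe.mp hj)
  have hspanS : h.thetaSpan m v = Submodule.span K S := by
    apply le_antisymm
    · intro θ hθ
      rw [hrep θ hθ]
      exact Submodule.sum_mem _ fun j hj => Submodule.smul_mem _ _ (Submodule.subset_span ⟨j, Finset.mem_coe.mpr hj, rfl⟩)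
    · exact Submodule.span_le.mpr hS
  have hderiv : Submodule.span K (h.derivSet S) = h.derivSpan P g := by
    unfold IsRootTower.derivSpan
    congr 1
    ext r
    constructor
    · rintro ⟨l, _, ⟨j, hj, rfl⟩, rfl⟩; exact ⟨l, j, Finset.mem_coe.mp hj, rfl⟩
    · rintro ⟨l, j, hj, rfl⟩; exact ⟨l, g j, ⟨j, Finset.mem_coe.mpr hj, rfl⟩, rfl⟩
  rw [h.thetaSpan_succ_eq_span m v hS (le_of_eq hspanS), Submodule.span_union, ← hspanS, hderiv]

/-- `Θ_m(v) ∩ N = 0`: `N` vanishes on the pivots, `Θ_m(v)` is read off the pivots. [cite: Mizutani1973HironakaGroupSchemes, proof of Thm. 2.8 (p. 90)] -/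
theorem IsRootTower.thetaSpan_inf_derivSpan_eq_bot [DecidableEq ι] (h : IsRootTower L K (p ^ 1) x a) (m : ℕ) (v : ι → K) {P : Finset ι}
    {g : ι → ι → K} (hpiv : ∀ j ∈ P, ∀ j' ∈ P, g j j' = if j = j' then 1 else 0)
    (hrep : ∀ θ ∈ h.thetaSpan m v, θ = ∑ j ∈ P, θ j • g j) :
    h.thetaSpan m v ⊓ h.derivSpan P g = ⊥ := by
  rw [eq_bot_iff]
  intro θ hθ
  rw [Submodule.mem_bot]
  exact eq_zero_of_forall_pivot_eq_zero hrep hθ.1 fun j hj => h.apply_eq_zero_of_mem_derivSpan hpiv hθ.2 hj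

/-- **THE STEP COUNT**: `dim_K Θ_{m+1}(v) = dim_K Θ_m(v) + dim_K N` for an echelon basis of `Θ_m(v)` with derivative span `N`
(exponent one). [cite: Mizutani1973HironakaGroupSchemes, proof of Thm. 2.8 (p. 90: dim Diff_{i+1}(k)f vs. dim Diff_i(k)f)] -/
theorem IsRootTower.finrank_thetaSpan_succ_eq [Fintype ι] [DecidableEq ι] (h : IsRootTower L K (p ^ 1) x a) (m : ℕ) (v : ι → K) {P : Finset ι}
    {g : ι → ι → K} (hmem : ∀ j ∈ P, g j ∈ h.thetaSpan m v) (hpiv : ∀ j ∈ P, ∀ j' ∈ P, g j j' = if j = j' then 1 else 0)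
    (hrep : ∀ θ ∈ h.thetaSpan m v, θ = ∑ j ∈ P, θ j • g j) :
    Module.finrank K (h.thetaSpan (m + 1) v) = Module.finrank K (h.thetaSpan m v) + Module.finrank K (h.derivSpan P g) := by
  haveI := h.thetaSpan_finite m v
  have := Submodule.finrank_sup_add_finrank_inf_eq (h.thetaSpan m v) (h.derivSpan P g)
  rw [h.thetaSpan_inf_derivSpan_eq_bot m v hpiv hrep, finrank_bot, add_zero, ← h.thetaSpan_succ_eq_sup_derivSpan m v hmem hrep]
    at this
  exact this

end Count

/-! ## Orthogonal vectors -/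

section Perp

variable {K : Type*} [Field K] {ι : Type*} [Fintype ι]

/-- **A subspace of dimension `< #ι` has a nonzero orthogonal vector** for the pairing `Σ_i w_i θ_i`. [folklore] -/
theorem exists_perp_of_finrank_lt (Θ : Submodule K (ι → K)) (hlt : Module.finrank K Θ < Fintype.card ι) :
    ∃ w : ι → K, w ≠ 0 ∧ ∀ θ ∈ Θ, ∑ i, w i * θ i = 0 := by
  classical
  set d := Module.finrank K Θ with hd
  set b := Module.finBasis K Θ with hb
  let A : Matrix (Fin d) ι K := fun j i => (b j : ι → K) i
  have hA : ∀ w j, A.mulVecLin w j = ∑ i, w i * (b j : ι → K) i := by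
    intro w j
    rw [Matrix.mulVecLin_apply, Matrix.mulVec, dotProduct]
    exact Finset.sum_congr rfl fun i _ => mul_comm _ _
  have hrange : Module.finrank K (LinearMap.range A.mulVecLin) ≤ d := by
    have := Submodule.finrank_le (LinearMap.range A.mulVecLin)
    rwa [Module.finrank_fintype_fun_eq_card, Fintype.card_fin] at this
  have hrn := LinearMap.finrank_range_add_finrank_ker A.mulVecLin
  rw [Module.finrank_fintype_fun_eq_card] at hrn
  have hker : 0 < Module.finrank K (LinearMap.ker A.mulVecLin) := by omega
  have hker_ne : LinearMap.ker A.mulVecLin ≠ ⊥ := by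
    intro hbot; rw [hbot, finrank_bot] at hker; exact lt_irrefl 0 hker
  obtain ⟨w, hw, hw0⟩ := Submodule.exists_mem_ne_zero_of_ne_bot hker_ne
  refine ⟨w, hw0, fun θ hθ => ?_⟩
  have hwj : ∀ j, ∑ i, w i * (b j : ι → K) i = 0 := fun j => by
    rw [← hA]; rw [LinearMap.mem_ker] at hw; rw [hw, Pi.zero_apply]
  -- expand `θ` in the basis `b`
  have hθrep : (θ : ι → K) = ∑ j, b.repr ⟨θ, hθ⟩ j • (b j : ι → K) := by
    conv_lhs => rw [show θ = ((⟨θ, hθ⟩ : Θ) : ι → K) from rfl, ← b.sum_repr ⟨θ, hθ⟩]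
    rw [Submodule.coe_sum]
    rfl
  rw [hθrep]
  simp only [Finset.sum_apply, Pi.smul_apply, smul_eq_mul, Finset.mul_sum]
  rw [Finset.sum_comm]
  refine Finset.sum_eq_zero fun j _ => ?_
  have : ∑ i, w i * (b.repr ⟨θ, hθ⟩ j * (b j : ι → K) i) = b.repr ⟨θ, hθ⟩ j * ∑ i, w i * (b j : ι → K) i := by
    rw [Finset.mul_sum]; exact Finset.sum_congr rfl fun i _ => by ring
  rw [this, hwj j, mul_zero]

variable {L : Type*} [Field L] [Algebra L K]

/-- **Rational orthogonal vectors**: if `w₀ ∈ K^ι` with `w₀(u₀) = 1` is orthogonal to vectors `g ∈ G` with coordinates in an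
intermediate field `E`, then some `w ∈ E^ι` with `w(u₀) = 1` is orthogonal to `G` (apply an `E`-linear retraction `K → E`). [folklore] -/
theorem exists_rational_perp (E : IntermediateField L K) {G : Set (ι → E)} {w₀ : ι → K} {u₀ : ι} (hw₀ : w₀ u₀ = 1)
    (hperp : ∀ g ∈ G, ∑ i, w₀ i * (g i : K) = 0) :
    ∃ w : ι → E, w u₀ = 1 ∧ ∀ g ∈ G, ∑ i, w i * g i = 0 := by
  -- an `E`-linear retraction of `E ⊆ K`
  have hinj : LinearMap.ker (Algebra.linearMap E K) = ⊥ :=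
    LinearMap.ker_eq_bot.mpr (algebraMap E K).injective
  obtain ⟨π, hπ⟩ := LinearMap.exists_leftInverse_of_injective (Algebra.linearMap E K) hinj
  have hπE : ∀ e : E, π (e : K) = e := fun e => by
    have := congrArg (fun φ : E →ₗ[E] E => φ e) hπ
    simpa using this
  refine ⟨fun i => π (w₀ i), by simp only [hw₀]; exact_mod_cast hπE 1, fun g hg => ?_⟩
  have key : ∑ i, π (w₀ i) * g i = π (∑ i, w₀ i * (g i : K)) := by
    rw [map_sum]
    refine Finset.sum_congr rfl fun i _ => ?_
    rw [mul_comm (w₀ i), show ((g i : K) * w₀ i) = g i • w₀ i from rfl, map_smul, smul_eq_mul, mul_comm]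
  rw [key, hperp g hg, map_zero]

end Perp

end Summit.ResolutionOfSingularities.KangarooAtlas.Mizutani

end
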